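import Summits.BirchSwinnertonDyer.BirchSwinnertonDyer.Theorems.SchneiderFreeAdditiveX3KYLambdaAlgImprimitiveEqOfPrintFiveLe
import Summits.BirchSwinnertonDyer.BirchSwinnertonDyer.Theorems.EisensteinPrimesBSDpOnCellCImprimitiveCountNonsplitOfPub
import Summits.BirchSwinnertonDyer.BirchSwinnertonDyer.Theorems.EisensteinPrimesFSideCorankLeOffP
import HarnessLib

/-!
# Route `SchneiderFreeAdditiveX3` (K1 door): the ALGEBRAIC λ-clause of Keller–Yin 2410.23241 §3.5 at `p ≥ 5`, PART 3 —
# down to the PRIMITIVE character duals: `λ(X_ac^{Sf}(E_K)) = λ(𝔛_{θsub}) + λ(𝔛_{θquot}) + Σ_{w ∈ Sf}(λ𝒫_w(θsub) + λ𝒫_w(θquot))`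
# and `λ(X_ac^∅(E_K)) + corank_E = ` the same, IN THE KERNEL modulo TEN PUBLISHED facts (CGLS 2022 ×4, Greenberg ×6)

Cell `bsd-schneider-ideate`, seat `bsd-schneider-door-c5` (prover, generation 24; assembly layer; `--supports` 19177).
PARTITION: board row B6 ∩ X3 ∩ sst-twist, `r = 1` (7 101 pairs; (G-ord, `e = 2`) half 2 560, (M) half 4 541), at
`p ≥ 5`; types-the-object-of nothing new; DERIVES the algebraic half of the `λ`-clause [INV.λ] of crux r3's preprint
input down to the objects of Rubin's main conjecture; closes none of B6's cells (BSD NOT advanced).  bears_on: K1-door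
(items 18971/18972 → 19177 r3 `GordTwoBranchIMC`) + K1-wing (20365).  Sequel of PARTS 1–2
(`…KYLambdaAlgImprimitiveOfPrintFiveLe`, `…KYLambdaAlgImprimitiveEqOfPrintFiveLe`: `λ(X_ac^{Sf}(E_K)) = λ(Dsub.X) + λ(Dquot.X)`
for all STRICT `Sf`-IMPRIMITIVE dual data, modulo eight published facts).

## Why / What

Castella–Grossi–Lee–Skinner 2022 Prop. 1.2.5 (`λ`-clause: "`λ(𝔛_θ^S) = λ(𝔛_θ) + Σ_{w∈Σ, w∤p} λ(𝒫_w(θ))`") takes the count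
of PART 2 down to the PRIMITIVE character duals `𝔛_θ` — the modules of Rubin's two-variable main conjecture — and the local
Euler-factor invariants `λ(𝒫_w(θ))` (`KellerYin2024.charLocalLambda`).  Cell `bsd-eis` proved that clause in the kernel at
CHARACTER level, REDUCTION-TYPE-FREE, modulo published facts (`CharGrSelmerCorankGeOfFacts.charLambdaRelaxation_eq_of_facts`,
width seat `bsd-line-x2-p2` generations 8–9: the `λ`-shift `GrSelmerImprimitiveLambdaShift`, the corank identity
`zpCorank_grSelmer_quotient_eq_sum_of_facts` from Greenberg 2016 Prop. 2.6.3 + Greenberg 2006 Props. 4.1/4.2/§5A/3.2 +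
CGLS Prop. 1.2.5's module clause), and discharged its character-level binders at a NON-SPLIT multiplicative datum
(`CharGrSelmerLambdaRelaxation.charHypotheses_of_not_split`).  This file discharges them at the door's datum instead
(the non-anomalous clause of `…SemistableTwistLocalAnyLine`, via PART 1's `localData_of_nonAnomalous`) and composes.

* §6 `charHypotheses_of_nonAnomalous` (REDUCTION-TYPE-FREE given the any-line clause `hna`) /
  `charHypotheses_of_classX3_of_subSemistableTwist` (`p ≥ 5`): every residual pair of `E_K[p]` satisfies CGLS §1.2's
  character-level binders at `S = Sf` (Teichmüller values; `Sf` prime to `p` over split primes; both residual characters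
  unramified outside `Sf ∪ {w ∣ p}`; `D_{v̄}` neither trivial nor cyclotomic on either).
* §7 **`lambdaInvariant_xAc_eq_add_add_sum_of_nonAnomalous_of_facts`** / **`…_of_classX3_of_subSemistableTwist_of_facts`**:
  `λ(X_ac^{Sf}(E_K)) = λ(D0sub.X) + λ(D0quot.X) + Σ_{w∈Sf}(charLocalLambda θsub w + charLocalLambda θquot w)` for ALL primitive
  strict dual data `D0sub`, `D0quot` — [ALG-imp] + [PWL-θ] of the Greenberg–Vatsal / CGLS count in ONE currency, modulo TEN
  published facts by name (CGLS22 Prop. 1.2.5 module clause, Prop. 14, Cor. 1.2.6 (i)(ii); Greenberg 2016 Props. 4.1.1, 2.6.3;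
  Greenberg 2006 Props. 4.1, 4.2, 3.2, §5 A) — NONE introduced by this seat.
* §8 **`lambdaInvariant_xAc_empty_add_zpCorank_eq_add_add_sum_of_classX3_of_subSemistableTwist_of_facts`**: the door's own
  module — `λ(X_ac^∅(E_K)) + corank_{ℤ_p}(Sel_{v̄}^{Sf}/Sel_{v̄}^∅) = λ(𝔛_{θsub}) + λ(𝔛_{θquot}) + Σ_{w∈Sf}(λ𝒫_w(θsub) + λ𝒫_w(θquot))`.
  After this file the ALGEBRAIC side of Keller–Yin 2410.23241 Thm. 3.5.1's "`λ(𝔛) = λ(𝓛_ε)`" for the door's curves at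
  `p ≥ 5` is kernel modulo PUBLISHED facts down to `{λ(𝔛_{θsub}), λ(𝔛_{θquot})}`; what remains of [INV.λ] there is Rubin's
  main conjecture for the two characters (`λ(𝔛_θ) = λ(𝓛_θ)`, PUBLISHED), the analytic comparison
  `λ(𝓛_ε) + corank_E = λ(𝓛_{θsub}) + λ(𝓛_{θquot}) + ΣΣ` (Keller–Yin §3.5's Eisenstein congruence for `f̃ ⊗ ε`, Katz, Hida —
  PREPRINT), and the evaluation `corank_E = Σ_{w∈Sf} λ(𝒫_w(E))` (Greenberg–Vatsal Prop. 2.4).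
* §9 **`add_add_sum_le_lambdaInvariant_xAc_empty_add_sum_curveLocalLambda_of_classX3_of_subSemistableTwist_of_facts`** — the
  INEQUALITY the door consumes, with NO corank left: `λ(𝔛_{θsub}) + λ(𝔛_{θquot}) + Σ_{w∈Sf}(λ𝒫_w(θsub) + λ𝒫_w(θquot)) ≤
  λ(X_ac^∅(E_K)) + Σ_{w∈Sf} λ𝒫_w(E_K)` (`λ𝒫_w(E_K) = KellerYin2024.curveLocalLambda`), by §8 and cell `bsd-eis`'s UNCONDITIONAL
  `FSideCorankLeOffP.zpCorank_selmerAc_quotient_le_sum_curveLocalLambda_of_offP_iff` (`corank_E ≤ Σ λ𝒫_w(E_K)`: Tate's algorithm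
  and PROVED Tate uniformisation place by place; Greenberg–Vatsal Prop. 2.4's easy half).  Why this direction is the door's: with
  [DIV.dvd] and `μ(𝔛) = μ(L₀) = 0` the characteristic series divides the frame, so `λ(𝔛) ≤ λ(L₀)` is automatic and the hinge
  (`KYBranchHalvesAlgebra`) needs only `λ(L₀) ≤ λ(𝔛)` — an UPPER bound on the frame's `λ` by the RIGHT-hand side above once the
  analytic side and Rubin's main conjecture evaluate the LEFT-hand side.

HONEST FRAMING: compositions of tree theorems, CONDITIONAL BY NAME on published facts typed as `Prop`s (not proved in the
tree); no definition, no named fact introduced, no `sorry`; nothing analytic is touched; nothing at `p = 3`; nothing about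
BSD or a main conjecture is asserted; «closes rung: none».
References: Keller–Yin arXiv:2410.23241 §3.5, Thm. 3.5.1 [KellerYin2024b]; Keller–Yin arXiv:2402.12781 Prop. 1.2.5, Thm. 1.4.1,
Thm. 1.5.1 [KellerYin2024]; Castella–Grossi–Lee–Skinner, Invent. Math. 227 (2022) §1.1 Lemma 1.1.1, §1.2 Prop. 1.2.5, Cor. 1.2.6,
Prop. 14, §1.4, Thm. 1.5.1 [CastellaGrossiLeeSkinner2022]; Greenberg 2016 Props. 2.6.3, 4.1.1 [Greenberg2016Selmer]; Greenberg 2006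
Props. 3.2, 4.1, 4.2, §5 A [Greenberg2006]; Greenberg–Vatsal 2000 §2 Cor. (2.3), Prop. (2.4) [GreenbergVatsal2000]; Pollack–Weston
2011 Prop. A.2 [PollackWeston2011]; cell `bsd-eis` p658583, p664472, p665096 (the non-split twins and the character-level theorems).
-/

set_option autoImplicit false
set_option linter.dupNamespace false -- the summit namespace `…BirchSwinnertonDyer.BirchSwinnertonDyer.Theorems` (Sub = Summit, D-0017) trips it

noncomputable section

open scoped Classical Pointwise

namespace Summit.BirchSwinnertonDyer.BirchSwinnertonDyer.Theorems.SchneiderFreeAdditiveX3.KYLambdaAlgChar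

open WeierstrassCurve NumberField IsDedekindDomain Field
  Literature.NumberTheory.EllipticCurves Literature.NumberTheory.EllipticCurves.IwasawaAlgebra
  Literature.NumberTheory.EllipticCurves.GreenbergSelmer
  Literature.NumberTheory.EllipticCurves.GreenbergVatsal2000
  Literature.NumberTheory.GaloisRepresentations IsDedekindDomain.HeightOneSpectrum
  Literature.NumberTheory.EllipticCurves.Rank1Residual Literature.NumberTheory.EllipticCurves.KellerYin2024
  Literature.NumberTheory.EllipticCurves.IwasawaDual Literature.NumberTheory.EllipticCurves.Castella2018.AcSelmer
  Literature.NumberTheory.IwasawaTheory Literature.NumberTheory.IwasawaTheory.Greenberg2016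
  Literature.NumberTheory.IwasawaTheory.Greenberg2006
  Summit.BirchSwinnertonDyer.Rank1Residual Summit.BirchSwinnertonDyer.Rank1Residual.Additive
  Summit.BirchSwinnertonDyer.Rank1Residual.X2.ResidualDevissageModules
  Summit.BirchSwinnertonDyer.BirchSwinnertonDyer.Theorems
  Summit.BirchSwinnertonDyer.BirchSwinnertonDyer.Theorems.ResidualDevissageNonsplitLocalData
  Summit.BirchSwinnertonDyer.BirchSwinnertonDyer.Theorems.ResidualDevissageNonsplitLambdaIdentityOfFacts
  Summit.BirchSwinnertonDyer.BirchSwinnertonDyer.Theorems.CumulativeHeegnerInclusionAtThreeResidualDevissage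
  Summit.BirchSwinnertonDyer.BirchSwinnertonDyer.Theorems.SchneiderFreeAdditiveX3
  Summit.BirchSwinnertonDyer.BirchSwinnertonDyer.Theorems.SchneiderFreeAdditiveX3.KYLambdaAlg
open Literature.NumberTheory.EllipticCurves.CastellaGrossiLeeSkinner2022
  (cor126_residualCharacter_globalLift cor126_residualCharacter_localSurjective
    prop125_characterGrSelmerDual_torsion_muZero_dim prop14_residualCharacterSelmer_finite)

variable {p : ℕ} [hp : Fact p.Prime]

/-! ### §6 The character-level binders of CGLS §1.2 for every residual pair, from the non-anomalous clause -/

/-- **Every residual pair of `E_K[p]` satisfies the character-level binders of CGLS §1.2 at `S = Sf`, GIVEN the non-anomalous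
clause for every order-`p` subgroup of `E[p]` at every prime above `p`** (`W/ℚ`, `K` imaginary quadratic with the Heegner
hypothesis for `N_W` and `(p)` split, `v̄ ∋ p`, any `ℤ_p`-extension `κ`, `Sf` = the places of `K` over `N_W` not over `p`): both
characters are Teichmüller-valued; `Sf` is prime to `p` over split rational primes; both residual characters are unramified outside
`Sf ∪ {w ∣ p}` (good reduction of `E` there); and `D_{v̄}` fixes neither `(F/𝒪)(θsub)[p]` nor `(F/𝒪)(θquot)[p]` pointwise and acts
on neither through `ω`.  REDUCTION-TYPE-FREE: cell `bsd-eis`'s `CharGrSelmerLambdaRelaxation.charHypotheses_of_not_split` VERBATIM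
with the Tate-curve step replaced by PART 1's `localData_of_nonAnomalous`.
[cite: CastellaGrossiLeeSkinner2022, §1.2 (standing hypotheses on θ) and Prop. 1.2.5]
[cite: KellerYin2024, §1.4 display (char to f) (arXiv:2402.12781v2 TeX L1066–1081)] -/
theorem charHypotheses_of_nonAnomalous (W : WeierstrassCurve ℚ) [W.IsElliptic]
    (K : Type) [Field K] [NumberField K] (vbar : HeightOneSpectrum (𝓞 K)) (κ : ZpExtension K p)
    (Sf : Finset (HeightOneSpectrum (𝓞 K)))
    (hK : IsImaginaryQuadratic K) (hH : SatisfiesHeegnerHypothesis (W.conductorNorm ℤ) K)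
    (hsplit : ((Ideal.span {(p : ℤ)}).primesOver (𝓞 K)).ncard = 2)
    (hvbar : ((p : ℕ) : 𝓞 K) ∈ vbar.asIdeal)
    (hSf : ∀ w : HeightOneSpectrum (𝓞 K), w ∈ Sf ↔
      (((W.conductorNorm ℤ : ℤ) : 𝓞 K) ∈ w.asIdeal ∧ ((p : ℕ) : 𝓞 K) ∉ w.asIdeal))
    (hna : ∀ (v : HeightOneSpectrum (𝓞 ℚ)), ((p : ℕ) : 𝓞 ℚ) ∈ v.asIdeal →
      ∀ (Φ : AddSubgroup (geomTorsion W (p : ℤ))), Nat.card Φ = p →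
      ∀ 𝔓 ∈ v.primesAbove,
        (¬ ∀ g ∈ 𝔓.decompositionSubgroup (absoluteGaloisGroup ℚ), ∀ P ∈ Φ, g • P = P) ∧
          (¬ ∀ g ∈ 𝔓.decompositionSubgroup (absoluteGaloisGroup ℚ),
            ∀ P : geomTorsion W (p : ℤ), g • P - P ∈ Φ))
    (θsub θquot : FramedGaloisRep K (padicCoeffIntegers (∅ : Set (PadicAlgCl p))) 1)
    (hpair : IsResidualPairOver (W.baseChange K) p θsub θquot) :
    (∀ v ∈ Sf, ((p : ℕ) : 𝓞 K) ∉ v.asIdeal ∧ ((v.asIdeal.under ℤ).primesOver (𝓞 K)).ncard = 2) ∧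
    ∀ θ : FramedGaloisRep K (padicCoeffIntegers (∅ : Set (PadicAlgCl p))) 1, (θ = θsub ∨ θ = θquot) →
      (∀ σ : absoluteGaloisGroup K, θ σ ^ (p - 1) = 1) ∧
      (∀ v : HeightOneSpectrum (𝓞 K), v ∉ Sf → ((p : ℕ) : 𝓞 K) ∉ v.asIdeal →
        ∀ x ∈ inertia v, ∀ m : charModule (∅ : Set (PadicAlgCl p)) θ, p • m = 0 → x • m = m) ∧
      (¬ ∀ g ∈ decomp vbar, ∀ m : charModule (∅ : Set (PadicAlgCl p)) θ, p • m = 0 → g • m = m) ∧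
      (¬ ∀ g ∈ decomp vbar, ∀ m : charModule (∅ : Set (PadicAlgCl p)) θ, p • m = 0 →
        g • m = ((modNCyclotomicCharacter K p g : (ZMod p)ˣ) : ZMod p).val • m) := by
  haveI hEK : (W.baseChange K).IsElliptic := inferInstanceAs (W.map (algebraMap ℚ K)).IsElliptic
  obtain ⟨hS₀mem, hgood⟩ := sf_split_and_good (p := p) W K Sf hH hSf
  -- the pair's stable line with its equivariant embeddings onto the `p`-torsion of the two character modules
  obtain ⟨S, hSub, -, ⟨jsub, hjsub, hjsub_inj, hjsub_range⟩, ⟨jquot, hjquot, hjquot_inj, hjquot_range⟩⟩ :=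
    ResidualPairStableLine.exists_stableLine_of_isResidualPairOver (W.baseChange K) hpair
  obtain ⟨-, hnon1, hnon2, hωS, hωQ, -⟩ := localData_of_nonAnomalous W K vbar κ hK hsplit hvbar hna S hSub
  -- good reduction outside `Sf ∪ {w ∣ p}`: inertia acts trivially on `E_K[p]`, hence on the line and the quotient
  have hunrE : ∀ w : HeightOneSpectrum (𝓞 K), w ∉ (↑Sf : Set (HeightOneSpectrum (𝓞 K))) → ((p : ℕ) : 𝓞 K) ∉ w.asIdeal →
      ∀ x ∈ inertia w, ∀ m : (W.baseChange K).geomTorsion ((p : ℕ) : ℤ), x • m = m :=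
    fun w hw hpw x hx m ↦ smul_geomTorsion_eq_of_mem_inertia_chosen (W.baseChange K) (hgood w hw hpw) hpw hx m
  refine ⟨fun v hv ↦ hS₀mem v (Finset.mem_coe.mpr hv), fun θ hθ ↦ ?_⟩
  rcases hθ with rfl | rfl
  · refine ⟨fun σ ↦ (hpair.pow_sub_one σ).1, fun w hw hpw ↦ ?_, ?_, ?_⟩
    · exact (forall_smul_eq_iff_of_embedding θ jsub hjsub hjsub_inj hjsub_range (inertia w)).mp
        fun x hx a ↦ S.incl_injective (by
          rw [StableSubgroup.incl_smul]; exact hunrE w (fun h ↦ hw (Finset.mem_coe.mp h)) hpw x hx _)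
    · exact fun h ↦ hnon1 ((forall_smul_eq_iff_of_embedding θ jsub hjsub hjsub_inj hjsub_range (decomp vbar)).mpr h)
    · exact fun h ↦ hωS ((forall_smul_eq_cyclotomic_iff_of_embedding θ jsub hjsub hjsub_inj hjsub_range (decomp vbar)).mpr h)
  · refine ⟨fun σ ↦ (hpair.pow_sub_one σ).2, fun w hw hpw ↦ ?_, ?_, ?_⟩
    · exact (forall_smul_eq_iff_of_embedding θ jquot hjquot hjquot_inj hjquot_range (inertia w)).mp
        fun x hx a ↦ by
          obtain ⟨n, rfl⟩ := S.proj_surjective a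
          rw [StableSubgroup.smul_proj, hunrE w (fun h ↦ hw (Finset.mem_coe.mp h)) hpw x hx]
    · exact fun h ↦ hnon2 ((forall_smul_eq_iff_of_embedding θ jquot hjquot hjquot_inj hjquot_range (decomp vbar)).mpr h)
    · exact fun h ↦ hωQ ((forall_smul_eq_cyclotomic_iff_of_embedding θ jquot hjquot hjquot_inj hjquot_range (decomp vbar)).mpr h)

/-- **The semistable-twist cells of B6 ∩ X3 at `p ≥ 5`: every residual pair of `E_K[p]` satisfies CGLS §1.2's character-level
binders at `S = Sf`** — §6 with `hna` from `SemistableTwistLocalAnyLine.not_fix_and_not_quot_of_classX3_of_subSemistableTwist_of_card_eq`.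
[cite: CastellaGrossiLeeSkinner2022, §1.2 (standing hypotheses on θ)] [cite: Serre1972, §1.11 Prop. 11 and §1.12 Prop. 13] -/
theorem charHypotheses_of_classX3_of_subSemistableTwist (W : WeierstrassCurve ℚ) [W.IsElliptic] [W.IsGloballyMinimal]
    (K : Type) [Field K] [NumberField K] (vbar : HeightOneSpectrum (𝓞 K)) (κ : ZpExtension K p)
    (Sf : Finset (HeightOneSpectrum (𝓞 K)))
    (hp5 : 5 ≤ p) (hX : ClassX3 W p) (hSST : SubSemistableTwist W p)
    (hK : IsImaginaryQuadratic K) (hH : SatisfiesHeegnerHypothesis (W.conductorNorm ℤ) K)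
    (hsplit : ((Ideal.span {(p : ℤ)}).primesOver (𝓞 K)).ncard = 2)
    (hvbar : ((p : ℕ) : 𝓞 K) ∈ vbar.asIdeal)
    (hSf : ∀ w : HeightOneSpectrum (𝓞 K), w ∈ Sf ↔
      (((W.conductorNorm ℤ : ℤ) : 𝓞 K) ∈ w.asIdeal ∧ ((p : ℕ) : 𝓞 K) ∉ w.asIdeal))
    (θsub θquot : FramedGaloisRep K (padicCoeffIntegers (∅ : Set (PadicAlgCl p))) 1)
    (hpair : IsResidualPairOver (W.baseChange K) p θsub θquot) :
    (∀ v ∈ Sf, ((p : ℕ) : 𝓞 K) ∉ v.asIdeal ∧ ((v.asIdeal.under ℤ).primesOver (𝓞 K)).ncard = 2) ∧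
    ∀ θ : FramedGaloisRep K (padicCoeffIntegers (∅ : Set (PadicAlgCl p))) 1, (θ = θsub ∨ θ = θquot) →
      (∀ σ : absoluteGaloisGroup K, θ σ ^ (p - 1) = 1) ∧
      (∀ v : HeightOneSpectrum (𝓞 K), v ∉ Sf → ((p : ℕ) : 𝓞 K) ∉ v.asIdeal →
        ∀ x ∈ inertia v, ∀ m : charModule (∅ : Set (PadicAlgCl p)) θ, p • m = 0 → x • m = m) ∧
      (¬ ∀ g ∈ decomp vbar, ∀ m : charModule (∅ : Set (PadicAlgCl p)) θ, p • m = 0 → g • m = m) ∧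
      (¬ ∀ g ∈ decomp vbar, ∀ m : charModule (∅ : Set (PadicAlgCl p)) θ, p • m = 0 →
        g • m = ((modNCyclotomicCharacter K p g : (ZMod p)ˣ) : ZMod p).val • m) :=
  charHypotheses_of_nonAnomalous W K vbar κ Sf hK hH hsplit hvbar hSf
    (fun _ hpv _ hΦ _ h𝔓 ↦
      SemistableTwistLocalAnyLine.not_fix_and_not_quot_of_classX3_of_subSemistableTwist_of_card_eq W p hp5 hX hSST hpv h𝔓 hΦ)
    θsub θquot hpair

/-! ### §7 [ALG-imp] + [PWL-θ] in one currency: down to the PRIMITIVE character duals and the local Euler factors -/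

/-- **`λ(X_ac^{Sf}(E_K)) = λ(𝔛_{θsub}) + λ(𝔛_{θquot}) + Σ_{w∈Sf}(λ𝒫_w(θsub) + λ𝒫_w(θquot))` at every Eisenstein Heegner datum with
the non-anomalous clause and EVERY residual pair, modulo TEN PUBLISHED facts by name** — PART 2's
`lambdaInvariant_xAc_eq_add_of_nonAnomalous_of_facts` ([ALG-imp], for auxiliary strict dual data at `Sf`, which exist
unconditionally) composed with cell `bsd-eis`'s character-level `CharGrSelmerCorankGeOfFacts.charLambdaRelaxation_eq_of_facts`
([PWL-θ] = CGLS Prop. 1.2.5's `λ`-clause: `λ(DS.X) = λ(D0.X) + Σ_{w∈S} charLocalLambda θ w`) for both characters, its binders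
supplied by §6.  `𝔛_θ = D0θ.X` for ANY primitive strict dual data (CGLS's `𝔛_θ`, the module of Rubin's main conjecture);
`λ𝒫_w(θ) = charLocalLambda ∅ κ θ w`.  Facts: CGLS22 Prop. 1.2.5 (module/dim), Prop. 14, Cor. 1.2.6 (i)(ii); Greenberg 2016 Props.
4.1.1, 2.6.3; Greenberg 2006 Props. 4.1, 4.2, 3.2, §5 A — all PUBLISHED, none introduced here.  REDUCTION-TYPE-FREE twin of
`bsd-eis`'s `lambdaInvariant_xAc_eq_add_add_sum_unr_of_not_split_of_pub` (strict currency).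
[cite: CastellaGrossiLeeSkinner2022, §1.2 Prop. 1.2.5 (λ-clause), Cor. 1.2.6, §1.4 Props. 1.4.1–1.4.2, proof of Thm. 1.5.1 (eq:lambda-imp)]
[cite: KellerYin2024, Prop. 1.2.5, Thm. 1.4.1, Thm. 1.5.1 (arXiv:2402.12781v2)] [cite: Greenberg2016Selmer, Props. 2.6.3, 4.1.1]
[cite: Greenberg2006, Props. 3.2, 4.1, 4.2, §5 A] [cite: GreenbergVatsal2000, §2 Cor. (2.3), Prop. (2.4)] -/
theorem lambdaInvariant_xAc_eq_add_add_sum_of_nonAnomalous_of_facts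
    (hprop125 : prop125_characterGrSelmerDual_torsion_muZero_dim) (hfact : prop14_residualCharacterSelmer_finite)
    (hlift : cor126_residualCharacter_globalLift) (hlocal : cor126_residualCharacter_localSurjective)
    (h411 : prop411_selmer_isAlmostDivisible) (h263 : prop263_sur_of_crk) (h41 : prop41_globalEulerPoincareCorank)
    (h42 : prop42_localEulerPoincareCorank) (h5A : sec5A_localH2_subsingleton_of_LOC1)
    (h32 : prop32_cohomology_isCofinitelyGenerated)
    (W : WeierstrassCurve ℚ) [W.IsElliptic] [W.IsGloballyMinimal]
    (K : Type) [Field K] [NumberField K] {v : HeightOneSpectrum (𝓞 K)} (vbar : HeightOneSpectrum (𝓞 K))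
    (κ : ZpExtension K p) (γ : absoluteGaloisGroup K) [hγ : Fact (κ.IsTopGenerator γ)]
    (Sf : Finset (HeightOneSpectrum (𝓞 K)))
    (hp2 : 2 < p) (hred : Red W p)
    (hK : IsImaginaryQuadratic K) (hH : SatisfiesHeegnerHypothesis (W.conductorNorm ℤ) K)
    (hsplit : ((Ideal.span {(p : ℤ)}).primesOver (𝓞 K)).ncard = 2)
    (hv : ((p : ℕ) : 𝓞 K) ∈ v.asIdeal) (hvbar : ((p : ℕ) : 𝓞 K) ∈ vbar.asIdeal) (hne : vbar ≠ v) (hκ : κ.IsAnticyclotomic)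
    (hSf : ∀ w : HeightOneSpectrum (𝓞 K), w ∈ Sf ↔
      (((W.conductorNorm ℤ : ℤ) : 𝓞 K) ∈ w.asIdeal ∧ ((p : ℕ) : 𝓞 K) ∉ w.asIdeal))
    (hna : ∀ (v : HeightOneSpectrum (𝓞 ℚ)), ((p : ℕ) : 𝓞 ℚ) ∈ v.asIdeal →
      ∀ (Φ : AddSubgroup (geomTorsion W (p : ℤ))), Nat.card Φ = p →
      ∀ 𝔓 ∈ v.primesAbove,
        (¬ ∀ g ∈ 𝔓.decompositionSubgroup (absoluteGaloisGroup ℚ), ∀ P ∈ Φ, g • P = P) ∧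
          (¬ ∀ g ∈ 𝔓.decompositionSubgroup (absoluteGaloisGroup ℚ),
            ∀ P : geomTorsion W (p : ℤ), g • P - P ∈ Φ))
    (θsub θquot : FramedGaloisRep K (padicCoeffIntegers (∅ : Set (PadicAlgCl p))) 1)
    (hpair : IsResidualPairOver (W.baseChange K) p θsub θquot)
    (D0sub : GrDualData κ (charModule (∅ : Set (PadicAlgCl p)) θsub) vbar (∅ : Set (HeightOneSpectrum (𝓞 K))) γ)
    (D0quot : GrDualData κ (charModule (∅ : Set (PadicAlgCl p)) θquot) vbar (∅ : Set (HeightOneSpectrum (𝓞 K))) γ) :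
    lambdaInvariant p (XAc (W.baseChange K) p κ vbar (↑Sf : Set (HeightOneSpectrum (𝓞 K))) γ) =
      lambdaInvariant p D0sub.X + lambdaInvariant p D0quot.X +
        ∑ w ∈ Sf, (charLocalLambda (∅ : Set (PadicAlgCl p)) κ θsub w + charLocalLambda (∅ : Set (PadicAlgCl p)) κ θquot w) := by
  have hp2' : p ≠ 2 := by omega
  -- auxiliary strict dual data at `Sf` exist unconditionally
  obtain ⟨Dsub⟩ := nonempty_grDualData_char (∅ : Set (PadicAlgCl p)) θsub κ vbar (↑Sf : Set (HeightOneSpectrum (𝓞 K))) hγ.out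
  obtain ⟨Dquot⟩ := nonempty_grDualData_char (∅ : Set (PadicAlgCl p)) θquot κ vbar (↑Sf : Set (HeightOneSpectrum (𝓞 K))) hγ.out
  have halg := lambdaInvariant_xAc_eq_add_of_nonAnomalous_of_facts hprop125 hfact hlift hlocal h411 h41 h42 h32 W K vbar κ γ Sf
    hp2 hred hK hH hsplit hv hvbar hne hκ hSf hna θsub θquot hpair Dsub Dquot
  obtain ⟨hSmem, hchar⟩ := charHypotheses_of_nonAnomalous W K vbar κ Sf hK hH hsplit hvbar hSf hna θsub θquot hpair
  obtain ⟨hθT₁, hunr₁, hne1₁, hneω₁⟩ := hchar θsub (Or.inl rfl)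
  obtain ⟨hθT₂, hunr₂, hne1₂, hneω₂⟩ := hchar θquot (Or.inr rfl)
  obtain ⟨-, -, -, hsub⟩ := CharGrSelmerCorankGeOfFacts.charLambdaRelaxation_eq_of_facts h263 h41 h42 h5A h32 hprop125 hK hp2'
    hsplit κ hκ γ hγ.out vbar hvbar θsub hθT₁ Sf hSmem hunr₁ hne1₁ hneω₁ Dsub D0sub
  obtain ⟨-, -, -, hquot⟩ := CharGrSelmerCorankGeOfFacts.charLambdaRelaxation_eq_of_facts h263 h41 h42 h5A h32 hprop125 hK hp2'
    hsplit κ hκ γ hγ.out vbar hvbar θquot hθT₂ Sf hSmem hunr₂ hne1₂ hneω₂ Dquot D0quot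
  rw [Finset.sum_add_distrib, halg, hsub, hquot]
  ring

/-- **On the semistable-twist cells of B6 ∩ X3 at `p ≥ 5`: `λ(X_ac^{Sf}(E_K)) = λ(𝔛_{θsub}) + λ(𝔛_{θquot}) +
Σ_{w∈Sf}(λ𝒫_w(θsub) + λ𝒫_w(θquot))` for every residual pair and ALL primitive strict dual data, modulo the ten published facts**
— §7 with `hna` from the cells.  Keller–Yin 2410.23241 §3.5's "the analysis on the algebraic side is exactly as in [KY24]" AS OUR
THEOREM there, down to the modules of Rubin's main conjecture.
[cite: KellerYin2024b, §3.5 first paragraph and Thm. 3.5.1 first sentence (arXiv:2410.23241 p. 20) (preprint; algebraic λ-side derived at p ≥ 5)]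
[cite: CastellaGrossiLeeSkinner2022, §1.2 Prop. 1.2.5, Cor. 1.2.6, Prop. 14, §1.4, proof of Thm. 1.5.1]
[cite: Greenberg2016Selmer, Props. 2.6.3, 4.1.1] [cite: Greenberg2006, Props. 3.2, 4.1, 4.2, §5 A] -/
theorem lambdaInvariant_xAc_eq_add_add_sum_of_classX3_of_subSemistableTwist_of_facts
    (hprop125 : prop125_characterGrSelmerDual_torsion_muZero_dim) (hfact : prop14_residualCharacterSelmer_finite)
    (hlift : cor126_residualCharacter_globalLift) (hlocal : cor126_residualCharacter_localSurjective)
    (h411 : prop411_selmer_isAlmostDivisible) (h263 : prop263_sur_of_crk) (h41 : prop41_globalEulerPoincareCorank)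
    (h42 : prop42_localEulerPoincareCorank) (h5A : sec5A_localH2_subsingleton_of_LOC1)
    (h32 : prop32_cohomology_isCofinitelyGenerated)
    (W : WeierstrassCurve ℚ) [W.IsElliptic] [W.IsGloballyMinimal]
    (K : Type) [Field K] [NumberField K] {v : HeightOneSpectrum (𝓞 K)} (vbar : HeightOneSpectrum (𝓞 K))
    (κ : ZpExtension K p) (γ : absoluteGaloisGroup K) [Fact (κ.IsTopGenerator γ)]
    (Sf : Finset (HeightOneSpectrum (𝓞 K)))
    (hp5 : 5 ≤ p) (hX : ClassX3 W p) (hSST : SubSemistableTwist W p)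
    (hK : IsImaginaryQuadratic K) (hH : SatisfiesHeegnerHypothesis (W.conductorNorm ℤ) K)
    (hsplit : ((Ideal.span {(p : ℤ)}).primesOver (𝓞 K)).ncard = 2)
    (hv : ((p : ℕ) : 𝓞 K) ∈ v.asIdeal) (hvbar : ((p : ℕ) : 𝓞 K) ∈ vbar.asIdeal) (hne : vbar ≠ v) (hκ : κ.IsAnticyclotomic)
    (hSf : ∀ w : HeightOneSpectrum (𝓞 K), w ∈ Sf ↔
      (((W.conductorNorm ℤ : ℤ) : 𝓞 K) ∈ w.asIdeal ∧ ((p : ℕ) : 𝓞 K) ∉ w.asIdeal))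
    (θsub θquot : FramedGaloisRep K (padicCoeffIntegers (∅ : Set (PadicAlgCl p))) 1)
    (hpair : IsResidualPairOver (W.baseChange K) p θsub θquot)
    (D0sub : GrDualData κ (charModule (∅ : Set (PadicAlgCl p)) θsub) vbar (∅ : Set (HeightOneSpectrum (𝓞 K))) γ)
    (D0quot : GrDualData κ (charModule (∅ : Set (PadicAlgCl p)) θquot) vbar (∅ : Set (HeightOneSpectrum (𝓞 K))) γ) :
    lambdaInvariant p (XAc (W.baseChange K) p κ vbar (↑Sf : Set (HeightOneSpectrum (𝓞 K))) γ) =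
      lambdaInvariant p D0sub.X + lambdaInvariant p D0quot.X +
        ∑ w ∈ Sf, (charLocalLambda (∅ : Set (PadicAlgCl p)) κ θsub w + charLocalLambda (∅ : Set (PadicAlgCl p)) κ θquot w) :=
  lambdaInvariant_xAc_eq_add_add_sum_of_nonAnomalous_of_facts hprop125 hfact hlift hlocal h411 h263 h41 h42 h5A h32 W K vbar κ γ
    Sf (by omega) hX.1 hK hH hsplit hv hvbar hne hκ hSf
    (fun _ hpv _ hΦ _ h𝔓 ↦
      SemistableTwistLocalAnyLine.not_fix_and_not_quot_of_classX3_of_subSemistableTwist_of_card_eq W p hp5 hX hSST hpv h𝔓 hΦ)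
    θsub θquot hpair D0sub D0quot

/-! ### §8 The door's PRIMITIVE dual against the primitive character duals -/

/-- **The ALGEBRAIC side of Keller–Yin 2410.23241 Thm. 3.5.1's "`λ(𝔛) = λ(𝓛_ε)`" for the door's own module `𝔛 = X_ac^∅(E_K)` at
`p ≥ 5` on BOTH semistable-twist cells, down to the primitive character duals, modulo the ten published facts:**
`λ(X_ac^∅(E_K)) + corank_{ℤ_p}(Sel_{v̄}^{Sf}/Sel_{v̄}^∅) = λ(𝔛_{θsub}) + λ(𝔛_{θquot}) + Σ_{w∈Sf}(λ𝒫_w(θsub) + λ𝒫_w(θquot))` for every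
residual pair of `E_K[p]` and ALL primitive strict dual data — PART 2 §5 (the door's `λ`-shift) combined with §7.  What remains of
[INV] `thm351_invariants_branch_OPEN`'s `λ`-clause there: Rubin's main conjecture for the two characters (`λ(𝔛_θ) = λ(𝓛_θ)`,
PUBLISHED), the analytic comparison of the branch frame with `𝓛_{θsub}`, `𝓛_{θquot}` (Keller–Yin §3.5's Eisenstein congruence for
`f̃ ⊗ ε`, Katz, Hida — PREPRINT) and the evaluation `corank = Σ_{w∈Sf} λ(𝒫_w(E))` (Greenberg–Vatsal Prop. 2.4).
[cite: KellerYin2024b, Thm. 3.5.1 first sentence "λ(𝔛) = λ(𝓛_ε)" and §3.5 (arXiv:2410.23241 p. 20) (preprint; algebraic side derived at p ≥ 5)]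
[cite: KellerYin2024, Prop. 1.2.5, Thm. 1.4.1, proof of Thm. 1.5.1 (arXiv:2402.12781v2)]
[cite: CastellaGrossiLeeSkinner2022, §1.2 Prop. 1.2.5, Cor. 1.2.6, Prop. 14, §1.4, proof of Thm. 1.5.1]
[cite: GreenbergVatsal2000, §2 Cor. (2.3), Prop. (2.4) and p. 21] [cite: Greenberg2016Selmer, Props. 2.6.3, 4.1.1] [cite: Greenberg2006, Props. 3.2, 4.1, 4.2, §5 A] -/
theorem lambdaInvariant_xAc_empty_add_zpCorank_eq_add_add_sum_of_classX3_of_subSemistableTwist_of_facts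
    (hprop125 : prop125_characterGrSelmerDual_torsion_muZero_dim) (hfact : prop14_residualCharacterSelmer_finite)
    (hlift : cor126_residualCharacter_globalLift) (hlocal : cor126_residualCharacter_localSurjective)
    (h411 : prop411_selmer_isAlmostDivisible) (h263 : prop263_sur_of_crk) (h41 : prop41_globalEulerPoincareCorank)
    (h42 : prop42_localEulerPoincareCorank) (h5A : sec5A_localH2_subsingleton_of_LOC1)
    (h32 : prop32_cohomology_isCofinitelyGenerated)
    (W : WeierstrassCurve ℚ) [W.IsElliptic] [W.IsGloballyMinimal]
    (K : Type) [Field K] [NumberField K] {v : HeightOneSpectrum (𝓞 K)} (vbar : HeightOneSpectrum (𝓞 K))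
    (κ : ZpExtension K p) (γ : absoluteGaloisGroup K) [hγ : Fact (κ.IsTopGenerator γ)]
    (Sf : Finset (HeightOneSpectrum (𝓞 K)))
    (hp5 : 5 ≤ p) (hX : ClassX3 W p) (hSST : SubSemistableTwist W p)
    (hK : IsImaginaryQuadratic K) (hH : SatisfiesHeegnerHypothesis (W.conductorNorm ℤ) K)
    (hsplit : ((Ideal.span {(p : ℤ)}).primesOver (𝓞 K)).ncard = 2)
    (hv : ((p : ℕ) : 𝓞 K) ∈ v.asIdeal) (hvbar : ((p : ℕ) : 𝓞 K) ∈ vbar.asIdeal) (hne : vbar ≠ v) (hκ : κ.IsAnticyclotomic)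
    (hSf : ∀ w : HeightOneSpectrum (𝓞 K), w ∈ Sf ↔
      (((W.conductorNorm ℤ : ℤ) : 𝓞 K) ∈ w.asIdeal ∧ ((p : ℕ) : 𝓞 K) ∉ w.asIdeal))
    (θsub θquot : FramedGaloisRep K (padicCoeffIntegers (∅ : Set (PadicAlgCl p))) 1)
    (hpair : IsResidualPairOver (W.baseChange K) p θsub θquot)
    (D0sub : GrDualData κ (charModule (∅ : Set (PadicAlgCl p)) θsub) vbar (∅ : Set (HeightOneSpectrum (𝓞 K))) γ)
    (D0quot : GrDualData κ (charModule (∅ : Set (PadicAlgCl p)) θquot) vbar (∅ : Set (HeightOneSpectrum (𝓞 K))) γ) :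
    lambdaInvariant p (XAc (W.baseChange K) p κ vbar (∅ : Set (HeightOneSpectrum (𝓞 K))) γ) +
        zpCorank (↥(selmerAc (W.baseChange K) p κ vbar (↑Sf : Set (HeightOneSpectrum (𝓞 K)))) ⧸
          (selmerAc (W.baseChange K) p κ vbar (∅ : Set (HeightOneSpectrum (𝓞 K)))).addSubgroupOf
            (selmerAc (W.baseChange K) p κ vbar (↑Sf : Set (HeightOneSpectrum (𝓞 K))))) p =
      lambdaInvariant p D0sub.X + lambdaInvariant p D0quot.X +
        ∑ w ∈ Sf, (charLocalLambda (∅ : Set (PadicAlgCl p)) κ θsub w + charLocalLambda (∅ : Set (PadicAlgCl p)) κ θquot w) := by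
  obtain ⟨Dsub⟩ := nonempty_grDualData_char (∅ : Set (PadicAlgCl p)) θsub κ vbar (↑Sf : Set (HeightOneSpectrum (𝓞 K))) hγ.out
  obtain ⟨Dquot⟩ := nonempty_grDualData_char (∅ : Set (PadicAlgCl p)) θquot κ vbar (↑Sf : Set (HeightOneSpectrum (𝓞 K))) hγ.out
  obtain ⟨-, -, -, hshift⟩ := lambdaInvariant_xAc_empty_add_zpCorank_eq_of_classX3_of_subSemistableTwist_of_facts hprop125 hfact
    hlift hlocal h411 h41 h42 h32 W K vbar κ γ Sf hp5 hX hSST hK hH hsplit hv hvbar hne hκ hSf θsub θquot hpair Dsub Dquot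
  have himp := lambdaInvariant_xAc_eq_add_of_classX3_of_subSemistableTwist_of_facts hprop125 hfact hlift hlocal h411 h41 h42 h32 W K
    vbar κ γ Sf hp5 hX hSST hK hH hsplit hv hvbar hne hκ hSf θsub θquot hpair Dsub Dquot
  have hchar := lambdaInvariant_xAc_eq_add_add_sum_of_classX3_of_subSemistableTwist_of_facts hprop125 hfact hlift hlocal h411 h263
    h41 h42 h5A h32 W K vbar κ γ Sf hp5 hX hSST hK hH hsplit hv hvbar hne hκ hSf θsub θquot hpair D0sub D0quot
  rw [hshift, ← himp, hchar]


/-! ### §9 The inequality the door consumes: no corank term left -/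

/-- **`λ(𝔛_{θsub}) + λ(𝔛_{θquot}) + Σ_{w∈Sf}(λ𝒫_w(θsub) + λ𝒫_w(θquot)) ≤ λ(X_ac^∅(E_K)) + Σ_{w∈Sf} λ𝒫_w(E_K)` at `p ≥ 5` on BOTH
semistable-twist cells of B6 ∩ X3, for every residual pair of `E_K[p]` and ALL primitive strict dual data, modulo the ten
published facts** — §8 combined with cell `bsd-eis`'s UNCONDITIONAL `corank_{ℤ_p}(Sel_{v̄}^{Sf}/Sel_{v̄}^∅) ≤ Σ_{w∈Sf} λ𝒫_w(E_K)`
(`FSideCorankLeOffP.zpCorank_selmerAc_quotient_le_sum_curveLocalLambda_of_offP_iff`: reduction type of `E` at `p` irrelevant;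
`λ𝒫_w(E_K) = KellerYin2024.curveLocalLambda κ E_K w`, the `λ`-invariant of the Euler factor `𝒫_w(f) ∈ Λ`).  This is the
direction the K1 door's hinge consumes (an upper bound on the branch frame's `λ` by `λ(𝔛)`, given the analytic count and
Rubin's main conjecture for the two characters); the reverse inequality (Greenberg–Vatsal Prop. 2.4's surjectivity half,
Pollack–Weston A.2) is NOT claimed.
[cite: KellerYin2024b, Thm. 3.5.1 first sentence "λ(𝔛) = λ(𝓛_ε)" (arXiv:2410.23241 p. 20) (preprint; algebraic side derived at p ≥ 5)]
[cite: GreenbergVatsal2000, §2 Cor. (2.3), Prop. (2.4) pp. 22–23] [cite: KellerYin2024, Prop. 1.2.5, Thm. 1.4.1, §1.5 (arXiv:2402.12781v2)]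
[cite: CastellaGrossiLeeSkinner2022, §1.2 Prop. 1.2.5, Cor. 1.2.6, Prop. 14, §1.4, (eq:1)] [cite: SilvermanATAEC1994, Ch. V Thm. 5.3, Cor. 5.4] -/
theorem add_add_sum_le_lambdaInvariant_xAc_empty_add_sum_curveLocalLambda_of_classX3_of_subSemistableTwist_of_facts
    (hprop125 : prop125_characterGrSelmerDual_torsion_muZero_dim) (hfact : prop14_residualCharacterSelmer_finite)
    (hlift : cor126_residualCharacter_globalLift) (hlocal : cor126_residualCharacter_localSurjective)
    (h411 : prop411_selmer_isAlmostDivisible) (h263 : prop263_sur_of_crk) (h41 : prop41_globalEulerPoincareCorank)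
    (h42 : prop42_localEulerPoincareCorank) (h5A : sec5A_localH2_subsingleton_of_LOC1)
    (h32 : prop32_cohomology_isCofinitelyGenerated)
    (W : WeierstrassCurve ℚ) [W.IsElliptic] [W.IsGloballyMinimal]
    (K : Type) [Field K] [NumberField K] {v : HeightOneSpectrum (𝓞 K)} (vbar : HeightOneSpectrum (𝓞 K))
    (κ : ZpExtension K p) (γ : absoluteGaloisGroup K) [hγ : Fact (κ.IsTopGenerator γ)]
    (Sf : Finset (HeightOneSpectrum (𝓞 K)))
    (hp5 : 5 ≤ p) (hX : ClassX3 W p) (hSST : SubSemistableTwist W p)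
    (hK : IsImaginaryQuadratic K) (hH : SatisfiesHeegnerHypothesis (W.conductorNorm ℤ) K)
    (hsplit : ((Ideal.span {(p : ℤ)}).primesOver (𝓞 K)).ncard = 2)
    (hv : ((p : ℕ) : 𝓞 K) ∈ v.asIdeal) (hvbar : ((p : ℕ) : 𝓞 K) ∈ vbar.asIdeal) (hne : vbar ≠ v) (hκ : κ.IsAnticyclotomic)
    (hSf : ∀ w : HeightOneSpectrum (𝓞 K), w ∈ Sf ↔
      (((W.conductorNorm ℤ : ℤ) : 𝓞 K) ∈ w.asIdeal ∧ ((p : ℕ) : 𝓞 K) ∉ w.asIdeal))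
    (θsub θquot : FramedGaloisRep K (padicCoeffIntegers (∅ : Set (PadicAlgCl p))) 1)
    (hpair : IsResidualPairOver (W.baseChange K) p θsub θquot)
    (D0sub : GrDualData κ (charModule (∅ : Set (PadicAlgCl p)) θsub) vbar (∅ : Set (HeightOneSpectrum (𝓞 K))) γ)
    (D0quot : GrDualData κ (charModule (∅ : Set (PadicAlgCl p)) θquot) vbar (∅ : Set (HeightOneSpectrum (𝓞 K))) γ) :
    lambdaInvariant p D0sub.X + lambdaInvariant p D0quot.X +
        ∑ w ∈ Sf, (charLocalLambda (∅ : Set (PadicAlgCl p)) κ θsub w + charLocalLambda (∅ : Set (PadicAlgCl p)) κ θquot w) ≤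
      lambdaInvariant p (XAc (W.baseChange K) p κ vbar (∅ : Set (HeightOneSpectrum (𝓞 K))) γ) +
        ∑ w ∈ Sf, curveLocalLambda κ (W.baseChange K) w := by
  have heq := lambdaInvariant_xAc_empty_add_zpCorank_eq_add_add_sum_of_classX3_of_subSemistableTwist_of_facts hprop125 hfact
    hlift hlocal h411 h263 h41 h42 h5A h32 W K vbar κ γ Sf hp5 hX hSST hK hH hsplit hv hvbar hne hκ hSf θsub θquot hpair D0sub
    D0quot
  have hle := FSideCorankLeOffP.zpCorank_selmerAc_quotient_le_sum_curveLocalLambda_of_offP_iff W (by omega) hK hH κ hκ hγ.out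
    vbar Sf hSf
  rw [← heq]
  exact Nat.add_le_add_left hle _

end Summit.BirchSwinnertonDyer.BirchSwinnertonDyer.Theorems.SchneiderFreeAdditiveX3.KYLambdaAlgChar

end
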